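import Summits.BirchSwinnertonDyer.Rank1Residual.Supersingular.GoodSSTowerOfSurj
import Summits.BirchSwinnertonDyer.Rank1Residual.Supersingular.SurjFrobeniusOrderCertificateShape
import Summits.BirchSwinnertonDyer.Rank1Residual.Additive.ThreeTorsionFullCubeDisc
import Summits.BirchSwinnertonDyer.Rank1Residual.Additive.X4ThreeKuriharaCertKernel
import HarnessLib

/-!
# Rank ONE at `p = 3`, `#Ш_an = 9`: the level-`3^k` Kurihara-number RECORD SHAPE with every side
# condition kernel-decidable — surj(3) by certificate, `ℓ ∈ 𝒫_k` from a point count, CYCLICITY by the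
# cube test `Δ^{(ℓ−1)/3} ≢ 1 (mod ℓ)`, the descent bit from the two-engine count `9 ∣ #Sel^(3)` —
# leaving as binders only the number `δ̃_ℓ ≢ 0 (mod 3^k)`, `r_an = 1`, `#Ш_an` (cell `b2b-bsdres`,
# supersingular family prover B = unit `b2b-bsdres-additive-p3`, gen 21; class lead N6·O3)

HONEST FRAMING (run/shared/lean/b2b/bsd-rank1-residual/, verbatim in every file): the goal of the
cell is to DELETE the COMBINATION-SHAPED residual classes of the Birch–Swinnerton-Dyer formula for
ALL analytic-rank `≤ 1` elliptic curves over `ℚ` — "full BSD formula for every rank `≤ 1` curve in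
class `C`" assembled STRICTLY from published theorems — so that the rank-`≤ 1` remainder becomes
exactly the CONSTRUCTION-SHAPED classes, which are TYPED (missing-input `Prop`s), NOT attempted.
This is not "finishing BSD". X8 / X7 stay CONSTRUCTION-SHAPED; THEOREMS ONLY (compositions of tree
theorems BY NAME; no definition, no named fact, debt 0); per pair; nothing booked; no mark moves.
Every theorem carries `hK25s : Kim2025.thm11_kimShaLength_of_integralPeriod_OPEN` — CONDITIONAL on
the ANNOUNCED preprint C.-H. Kim (app. R. Pollack), arXiv:2505.09121 (OPEN binder; its `p = 3`
Kolyvagin systems = Sakamoto, JTNB 36 (2024), refereed); `hCT` / `hGZK` / `hmod` are PUBLISHED.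

## Why (O3 = X8 ∧ `r_an = 1`, the 22 `#Ш_an = 9` cells; CLASS-CLOSURE LEVEL-27 STAGE 1, complete
2026-08-21T20:58Z: cc-eng-3 engine D / mstw + cc-eng-1 folds, `class-closure/O3/LEVEL27-STAGE1-status-eng1.tsv`)

Gen 18's `X8RankOne.bsdp_three_of_kim2025_OPEN_of_kuriharaNumber_ne_zero_of_three_dvd_of_frobenius`
(p264912) closes such a pair from ONE Kurihara number `δ̃_ℓ ≢ 0 (mod 3^k)` at a cyclic Kolyvagin prime
`ℓ ∈ 𝒫_k`, `k ≤ 4`, plus the descent bit `3 ∣ #Ш(E/ℚ)`; gen 21's `…_of_surj` (`GoodSSTowerOfSurj.lean`,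
p306705) drops the tower witness. STAGE 1 tabled `δ̃_ℓ mod 27` at two level-27 primes for each of the
22 rows: 19 rows NONVANISHING mod 27 at some `ℓ ∈ 𝒫_3` (8 of them on TWO engines at `ℓ ≤ 1999`), 3 rows
vanishing at both (two of which have `ord₃ ∏c_ℓ = 1`, where Kim's Conj. 1.10 predicts vanishing below
level `3^4`). This file turns the consumer into a RECORD SHAPE whose every side condition is decided in
the kernel on the literal equation, so that a per-row record is ONE `exact` with, as binders, exactly:
the OPEN `hK25s`; PUBLISHED `hCT`, `hGZK`, `hmod`; the modular parametrisation `D` (newform `D.f`);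
a surjective `ψ_ℓ : (ℤ/ℓ)ˣ → ℤ/3^k` and the number `kuriharaNumber D.f (3^k) ℓ ψ ≠ 0` (engine datum, or
a depth-`k` twist record `CertifiedK`); the two-engine descent count `9 ∣ #Sel^(3)(E/ℚ)` (gen 19,
22/22 rows); Cremona's `r_an = 1` and `#Ш_an`.

* §1 (model-free) `X8RankOne.bsdp_three_of_kim2025_OPEN_of_kuriharaNumber_ne_zero_of_card_selmerGroup_of_surj`:
  the descent bit `3 ∣ #Ш` DERIVED from `9 ∣ #Sel^(3)` (`pow_dvd_shaOrder_of_dvd_card_selmerGroup_pow`,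
  gen 19; rank `1` by GZK; `3 ∤ #E(ℚ)_tors` from irreducibility ⇐ surj(3)); X7@3 twin.
* §2 (integer model `integralModelInt W = E₀`) `…_of_intModel_…`: `ℓ ∈ 𝒫_k` from `ℓ ∤ Δ(E₀)`, `ℓ ≠ 3`,
  `ℓ ≡ 1 (mod 3^k)` and a point count `#(E₀ mod ℓ)(𝔽_ℓ) = n_ℓ` with `3^k ∣ n_ℓ` (n1011's
  `Additive.isKolyvaginPrime_of_intModel_of_card`); CYCLICITY `#Ẽ(𝔽_ℓ)[3] ≤ 3` from the CUBE TEST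
  `Δ(E₀ mod ℓ) ≠ 0`, `Δ(E₀ mod ℓ)^{(ℓ−1)/3} ≠ 1` (n1011-p15's
  `Additive.card_three_torsion_le_of_intModel_of_pow_div_three_ne_one`, p305396) — at a Kolyvagin prime
  (`ℓ ≡ 1`, `a_ℓ ≡ 2 (mod 3)`) the test is also NECESSARY: a non-identity unipotent Frobenius on `E[3]`
  maps to a `3`-cycle of `GL₂(𝔽₃)/Q₈ ≅ S₃ = Gal(ℚ(ζ₃, ∛Δ)/ℚ)`, so it moves `∛Δ`; class X8 from
  `3 ∤ Δ(E₀)` and `#(E₀ mod 3)(𝔽₃) ∈ {1, 7}` (gen 20 `classX8_of_intModel`).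
* §3 (literal equation `[a₁,…,a₆]`, no instance hypothesis) `…_of_ainvs_…`: global minimality explicit
  (x11c's bounded criterion / gen 20's criterion₃ — records decide it), the two counts in x11c's schema /
  `Nat.card` form, the cube test on `(Δ : ZMod ℓ)`; `surj(3)` is the binder `hsurj` that gen 21's
  certificates `surj_x8r1_<label>_3` (`RankOneSurjThreeCertificates_*`) discharge by name.

NOT claimed: no class theorem; the number `δ̃_ℓ` is NOT computed here (binder); nothing on the 3 rows
vanishing mod 27 at both STAGE-1 primes; nothing booked; O3's mark (NEEDS X_B3) does not move.

References: [Kim2025RefinedTNC] Thm. 1.1 (ANNOUNCED, OPEN binder); [Kim2022StructureSelmer] §1.2.2,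
Thm. 1.10 (1), Conj. 1.10; [SilvermanAEC2009] III.1, X.4.2 (a), X.4.14; [Wuthrich2014] Lemma 20 (p. 399);
[Cremona1997] §3.6; [Miller2011LMS] §1, Def. 1.1.
-/

set_option autoImplicit false

noncomputable section

open scoped Classical MatrixGroups ModularForm

open CongruenceSubgroup WeierstrassCurve Literature.NumberTheory.EllipticCurves
  Literature.NumberTheory.EllipticCurves.ModularForms
  Literature.NumberTheory.EllipticCurves.Rank1Residual
  Literature.NumberTheory.EllipticCurves.Rank1Residual.Typed
  Literature.NumberTheory.EllipticCurves.Rank1Residual.X11RankOneCertificates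
  Summit.BirchSwinnertonDyer.BirchSwinnertonDyer.Rank1Residual.IntModel
  Summit.BirchSwinnertonDyer.BirchSwinnertonDyer.Rank1Residual.X11RankOne
  Summit.BirchSwinnertonDyer.Rank1Residual.X11b
  Summit.BirchSwinnertonDyer.Rank1Residual.Additive

namespace Summit.BirchSwinnertonDyer.Rank1Residual.Supersingular

/-! ### §1 Model-free: the descent bit from the count `9 ∣ #Sel^(3)(E/ℚ)` -/

section ModelFree

variable (W : WeierstrassCurve ℚ) [W.IsElliptic] [W.IsGloballyMinimal]

omit [W.IsGloballyMinimal] in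
/-- `3 ∣ #Ш(E/ℚ)` on a rank-one pair from the descent count `9 ∣ #Sel^(3)(E/ℚ)` (GZK: rank `= r_an = 1`;
`3 ∤ #E(ℚ)_tors` from irreducibility). [cite: SilvermanAEC2009, Thm X.4.2(a)] [cite: Cremona1997, §3.6, p. 73] -/
theorem three_dvd_shaOrder_of_rankOne_of_irr_of_card_selmerGroup
    (hGZK : rank_eq_analyticRank_of_analyticRank_le_one) (hr : W.analyticRank = 1) (hirr : Irr W 3)
    (hcard : 3 ^ 2 ∣ Nat.card (W.selmerGroup ((3 : ℕ) : ℤ))) : 3 ∣ W.shaOrder := by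
  have hrank : W.mordellWeilRank = 1 := by rw [(hGZK W (by rw [hr])).1, hr]
  have h := pow_dvd_shaOrder_of_dvd_card_selmerGroup_pow W 3 1 (not_dvd_torsionOrder_of_irr W 3 hirr)
    (m := 1) (by rw [show 1 * W.mordellWeilRank + 1 = 2 by rw [hrank], pow_one]; exact hcard)
  simpa using h

/-- **O3's `#Ш_an = 9` rows, model-free END: `BSD(E,3)` from ONE Kurihara number `≢ 0 (mod 3^k)` at a
cyclic Kolyvagin prime `ℓ ∈ 𝒫_k`, `1 ≤ k ≤ 4`, the two-engine DESCENT COUNT `9 ∣ #Sel^(3)(E/ℚ)` and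
`ord₃ #Ш_an = 2`** (X8 ∧ `r_an = 1` ∧ surj(3); tower from surj(3) alone). CONDITIONAL on `hK25s` (OPEN);
`hCT`, `hGZK`, `hmod` PUBLISHED. Per pair; NOT a class theorem. [claim: Kim2025RefinedTNC, status: under-review]
[cite: Kim2025RefinedTNC, Thm. 1.1 (ANNOUNCED, OPEN binder)] [cite: SilvermanAEC2009, Thm. X.4.2(a) and Thm. X.4.14]
[cite: Wuthrich2014, Lemma 20 (p. 399)] [cite: Miller2011LMS, §1 and Def. 1.1] -/
theorem X8RankOne.bsdp_three_of_kim2025_OPEN_of_kuriharaNumber_ne_zero_of_card_selmerGroup_of_surj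
    (hK25s : Kim2025.thm11_kimShaLength_of_integralPeriod_OPEN)
    (hCT : exists_casselsTate_pairing (K := ℚ))
    (hGZK : rank_eq_analyticRank_of_analyticRank_le_one) (hmod : hasEntireLFunction_rat)
    (hr : W.analyticRank = 1) (hX : ClassX8 W 3) (hs : Surj W 3)
    {N : ℕ} [NeZero N] (D : ModularParametrizationData W N)
    {k : ℕ} (hk : 1 ≤ k) (hk4 : k ≤ 4) (ℓ : ℕ) [Fact ℓ.Prime] (hℓ : Kato.IsKolyvaginPrime W 3 k ℓ)
    (hcyc : Nat.card {P : ((WeierstrassCurve.integralModelInt W).map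
        (Int.castRingHom (ZMod ℓ))).toAffine.Point // 3 • P = 0} ≤ 3)
    (ψ : (ℓ'' : ℕ) → (ZMod ℓ'')ˣ →* Multiplicative (ZMod (3 ^ k)))
    (hψ : Function.Surjective (ψ ℓ)) (hδ : kuriharaNumber D.f (3 ^ k) ℓ ψ ≠ 0)
    (hcard : 3 ^ 2 ∣ Nat.card (W.selmerGroup ((3 : ℕ) : ℤ)))
    {q : ℚ} (hq : shaAn W = (q : ℂ)) (hv : padicValRat 3 q = 2) : BSDp W 3 :=
  X8RankOne.bsdp_three_of_kim2025_OPEN_of_kuriharaNumber_ne_zero_of_three_dvd_of_surj W hK25s hCT hGZK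
    hmod hr hX hs D hk hk4 ℓ hℓ hcyc ψ hψ hδ
    (three_dvd_shaOrder_of_rankOne_of_irr_of_card_selmerGroup W hGZK hr
      (hasIrreducibleModPGaloisRep_of_hasSurjectiveModNGaloisRep W 3 hs) hcard) hq hv

/-- **O4@3's `#Ш_an = 9` rows (X7@3 ∧ `r_an = 1` ∧ surj(3)), model-free END** — the X7 twin (tower by
`ClassX7.towerSurj_of_surj`). CONDITIONAL on `hK25s` (OPEN); X7 joint pair, B side. Per pair.
[claim: Kim2025RefinedTNC, status: under-review] [cite: Kim2025RefinedTNC, Thm. 1.1 (ANNOUNCED, OPEN binder)]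
[cite: SilvermanAEC2009, Thm. X.4.2(a) and Thm. X.4.14] [cite: Wuthrich2014, Lemma 20 (p. 399)]
[cite: Miller2011LMS, §1 and Def. 1.1] -/
theorem X7RankOne.bsdp_three_of_kim2025_OPEN_of_kuriharaNumber_ne_zero_of_card_selmerGroup_of_surj
    (hK25s : Kim2025.thm11_kimShaLength_of_integralPeriod_OPEN)
    (hCT : exists_casselsTate_pairing (K := ℚ))
    (hGZK : rank_eq_analyticRank_of_analyticRank_le_one) (hmod : hasEntireLFunction_rat)
    (hr : W.analyticRank = 1) (hX : ClassX7 W 3) (hs : Surj W 3)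
    {N : ℕ} [NeZero N] (D : ModularParametrizationData W N)
    {k : ℕ} (hk : 1 ≤ k) (hk4 : k ≤ 4) (ℓ : ℕ) [Fact ℓ.Prime] (hℓ : Kato.IsKolyvaginPrime W 3 k ℓ)
    (hcyc : Nat.card {P : ((WeierstrassCurve.integralModelInt W).map
        (Int.castRingHom (ZMod ℓ))).toAffine.Point // 3 • P = 0} ≤ 3)
    (ψ : (ℓ'' : ℕ) → (ZMod ℓ'')ˣ →* Multiplicative (ZMod (3 ^ k)))
    (hψ : Function.Surjective (ψ ℓ)) (hδ : kuriharaNumber D.f (3 ^ k) ℓ ψ ≠ 0)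
    (hcard : 3 ^ 2 ∣ Nat.card (W.selmerGroup ((3 : ℕ) : ℤ)))
    {q : ℚ} (hq : shaAn W = (q : ℂ)) (hv : padicValRat 3 q = 2) : BSDp W 3 := by
  have h3 := three_dvd_shaOrder_of_rankOne_of_irr_of_card_selmerGroup W hGZK hr
    (hasIrreducibleModPGaloisRep_of_hasSurjectiveModNGaloisRep W 3 hs) hcard
  exact RankOne.bsdp_of_kim2025_OPEN_of_casselsTate_of_kuriharaNumber_ne_zero_of_pow_dvd W 3 hK25s hCT hGZK
    hmod le_rfl hr (ClassX7.towerSurj_of_surj W 3 (by decide) hX hs) D (j := 1) hk (by omega) ℓ hℓ hcyc ψ hψ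
    hδ (by simpa using h3) hq (by rw [hv]; norm_num)

end ModelFree

/-! ### §2 Read off an integer model `integralModelInt W = E₀`: `ℓ ∈ 𝒫_k` from the count, cyclicity
from the cube test -/

section IntModel

variable {W : WeierstrassCurve ℚ} [W.IsElliptic] [W.IsGloballyMinimal] {E₀ : WeierstrassCurve ℤ}

/-- `3 ∣ ℓ − 1` from `ℓ ≡ 1 (mod 3^k)`, `k ≥ 1`. [folklore] -/
theorem three_dvd_sub_one_of_modEq_pow {ℓ k : ℕ} (hk : 1 ≤ k) (h1 : ℓ ≡ 1 [MOD 3 ^ k]) :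
    3 ∣ ℓ - 1 := by
  have h3 : 1 ≡ ℓ [MOD 3] := (h1.of_dvd (dvd_pow_self 3 (by omega))).symm
  rcases Nat.eq_zero_or_pos ℓ with rfl | hpos
  · simp
  · exact (Nat.modEq_iff_dvd' hpos).mp h3

/-- **Integer-model END (X8 ∧ `r_an = 1` ∧ surj(3), `ord₃ #Ш_an = 2`)**: class X8 from `3 ∤ Δ(E₀)` and
`#(E₀ mod 3)(𝔽₃) ∈ {1,7}`; `ℓ ∈ 𝒫_k` from `ℓ ≠ 3`, `ℓ ∤ Δ(E₀)`, `ℓ ≡ 1 (mod 3^k)`, `#(E₀ mod ℓ)(𝔽_ℓ) = n_ℓ`,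
`3^k ∣ n_ℓ`; CYCLICITY from the cube test `Δ(E₀ mod ℓ) ≠ 0`, `Δ(E₀ mod ℓ)^{(ℓ−1)/3} ≠ 1`; then §1.
CONDITIONAL on `hK25s` (OPEN). Per pair; NOT a class theorem. [claim: Kim2025RefinedTNC, status: under-review]
[cite: Kim2025RefinedTNC, Thm. 1.1 (ANNOUNCED, OPEN binder)] [cite: Kim2022StructureSelmer, §1.2.2 and Thm. 1.10 (1)]
[cite: SilvermanAEC2009, III.1, VII.5 Prop. 5.1(a), Thm. X.4.2(a), Thm. X.4.14] [cite: Miller2011LMS, §1 and Def. 1.1] -/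
theorem X8RankOne.bsdp_three_of_kim2025_OPEN_of_intModel_of_kuriharaNumber_ne_zero_of_card_selmerGroup
    (hK25s : Kim2025.thm11_kimShaLength_of_integralPeriod_OPEN)
    (hCT : exists_casselsTate_pairing (K := ℚ))
    (hGZK : rank_eq_analyticRank_of_analyticRank_le_one) (hmod : hasEntireLFunction_rat)
    (hI : integralModelInt W = E₀) (h3Δ : ¬ (3 : ℤ) ∣ E₀.Δ) {n₃ : ℕ}
    (hn₃ : Nat.card ((E₀.map (Int.castRingHom (ZMod 3))).toAffine.Point) = n₃) (hn17 : n₃ = 1 ∨ n₃ = 7)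
    (hs : Surj W 3) (hr : W.analyticRank = 1)
    {N : ℕ} [NeZero N] (D : ModularParametrizationData W N)
    {k : ℕ} (hk : 1 ≤ k) (hk4 : k ≤ 4) (ℓ : ℕ) [Fact ℓ.Prime] (hℓ3 : ℓ ≠ 3) (h5 : 5 ≤ ℓ)
    (hℓΔ : ¬ (ℓ : ℤ) ∣ E₀.Δ) (h1 : ℓ ≡ 1 [MOD 3 ^ k]) {nℓ : ℕ}
    (hnℓ : Nat.card ((E₀.map (Int.castRingHom (ZMod ℓ))).toAffine.Point) = nℓ) (hdvd : 3 ^ k ∣ nℓ)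
    (hΔ0 : (E₀.map (Int.castRingHom (ZMod ℓ))).Δ ≠ 0)
    (hχ : (E₀.map (Int.castRingHom (ZMod ℓ))).Δ ^ ((ℓ - 1) / 3) ≠ 1)
    (ψ : (ℓ'' : ℕ) → (ZMod ℓ'')ˣ →* Multiplicative (ZMod (3 ^ k)))
    (hψ : Function.Surjective (ψ ℓ)) (hδ : kuriharaNumber D.f (3 ^ k) ℓ ψ ≠ 0)
    (hcard : 3 ^ 2 ∣ Nat.card (W.selmerGroup ((3 : ℕ) : ℤ)))
    {q : ℚ} (hq : shaAn W = (q : ℂ)) (hv : padicValRat 3 q = 2) : BSDp W 3 :=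
  haveI : Fact (Nat.Prime 3) := ⟨by norm_num⟩
  X8RankOne.bsdp_three_of_kim2025_OPEN_of_kuriharaNumber_ne_zero_of_card_selmerGroup_of_surj W hK25s hCT
    hGZK hmod hr (classX8_of_intModel hI h3Δ hn₃ hn17) hs D hk hk4 ℓ
    (isKolyvaginPrime_of_intModel_of_card hI 3 k ℓ hℓ3 hℓΔ h1 hnℓ hdvd)
    (card_three_torsion_le_of_intModel_of_pow_div_three_ne_one hI ℓ hΔ0 hχ h5
      (three_dvd_sub_one_of_modEq_pow hk h1)) ψ hψ hδ hcard hq hv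

end IntModel

/-! ### §3 Literal integer equations `[a₁, a₂, a₃, a₄, a₆]` -/

section Literal

/-- **RECORD SHAPE (O3's `#Ш_an = 9` rows).** For an integer equation `[a₁,…,a₆]`: `hmin` global
minimality (explicit — x11c's bounded criterion or gen 20's criterion₃, decided by the record), `3 ∤ Δ`,
schema count `countPoints [a] 3 ∈ {1,7}` (class X8); a prime `ℓ ≥ 5`, `ℓ ∤ Δ`, `ℓ ≡ 1 (mod 3^k)`
(`1 ≤ k ≤ 4`), `#(E mod ℓ)(𝔽_ℓ) = n_ℓ` (x11c's schema / gen 20's pow form), `3^k ∣ n_ℓ`, and the CUBE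
TEST `(Δ : ℤ/ℓ) ≠ 0`, `(Δ : ℤ/ℓ)^{(ℓ−1)/3} ≠ 1` — ALL kernel-decidable (the prime fact is the named
instance binder `hℓ`, supplied by a record as `(hℓ := ⟨by norm_num⟩)`); binders: `hsurj` (= gen 21's
certificate `surj_x8r1_<label>_3`), `r_an = 1`, `D`, a surjective `ψ_ℓ` with
`kuriharaNumber D.f (3^k) ℓ ψ ≠ 0`, the two-engine descent count `9 ∣ #Sel^(3)`, `#Ш_an = q`,
`ord₃ q = 2` ⇒ **`BSD(E,3)`**. CONDITIONAL on `hK25s` (OPEN) + `hCT`/`hGZK`/`hmod` (PUBLISHED). Per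
pair; NOT a class theorem; nothing booked. [claim: Kim2025RefinedTNC, status: under-review]
[cite: Kim2025RefinedTNC, Thm. 1.1 (ANNOUNCED, OPEN binder)] [cite: Kim2022StructureSelmer, §1.2.2 and Thm. 1.10 (1)]
[cite: SilvermanAEC2009, III.1, VII.1 Remark 1.1, VII.5 Prop. 5.1(a), Thm. X.4.2(a), Thm. X.4.14]
[cite: IrelandRosen1990, Prop. 5.1.2 and §8.1] [cite: Miller2011LMS, §1 and Def. 1.1] -/
theorem X8RankOne.bsdp_three_of_kim2025_OPEN_of_ainvs_of_kuriharaNumber_ne_zero_of_card_selmerGroup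
    (hK25s : Kim2025.thm11_kimShaLength_of_integralPeriod_OPEN)
    (hCT : exists_casselsTate_pairing (K := ℚ))
    (hGZK : rank_eq_analyticRank_of_analyticRank_le_one) (hmod : hasEntireLFunction_rat)
    (a1 a2 a3 a4 a6 : ℤ) (hmin : (⟨a1, a2, a3, a4, a6⟩ : WeierstrassCurve ℚ).IsGloballyMinimal)
    (h3Δ : ¬ (3 : ℤ) ∣ discOf [a1, a2, a3, a4, a6]) {n₃ : ℕ}
    (hc₃ : countPoints [a1, a2, a3, a4, a6] 3 = n₃) (hn17 : n₃ = 1 ∨ n₃ = 7)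
    (hsurj : Surj (⟨a1, a2, a3, a4, a6⟩ : WeierstrassCurve ℚ) 3)
    (hr : (⟨a1, a2, a3, a4, a6⟩ : WeierstrassCurve ℚ).analyticRank = 1)
    {N : ℕ} [NeZero N] (D : ModularParametrizationData (⟨a1, a2, a3, a4, a6⟩ : WeierstrassCurve ℚ) N)
    {k : ℕ} (hk : 1 ≤ k) (hk4 : k ≤ 4) (ℓ : ℕ) [hℓ : Fact ℓ.Prime] (h5 : 5 ≤ ℓ)
    (hℓΔ : ¬ (ℓ : ℤ) ∣ discOf [a1, a2, a3, a4, a6]) (h1 : ℓ ≡ 1 [MOD 3 ^ k]) {nℓ : ℕ}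
    (hnℓ : Nat.card (((⟨a1, a2, a3, a4, a6⟩ : WeierstrassCurve ℤ).map
      (Int.castRingHom (ZMod ℓ))).toAffine.Point) = nℓ) (hdvd : 3 ^ k ∣ nℓ)
    (hΔ0 : ((discOf [a1, a2, a3, a4, a6] : ℤ) : ZMod ℓ) ≠ 0)
    (hχ : ((discOf [a1, a2, a3, a4, a6] : ℤ) : ZMod ℓ) ^ ((ℓ - 1) / 3) ≠ 1)
    (ψ : (ℓ'' : ℕ) → (ZMod ℓ'')ˣ →* Multiplicative (ZMod (3 ^ k)))
    (hψ : Function.Surjective (ψ ℓ))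
    (hδ : kuriharaNumber D.f (3 ^ k) ℓ ψ ≠ 0)
    (hcard : 3 ^ 2 ∣ Nat.card ((⟨a1, a2, a3, a4, a6⟩ : WeierstrassCurve ℚ).selmerGroup ((3 : ℕ) : ℤ)))
    {q : ℚ} (hq : shaAn (⟨a1, a2, a3, a4, a6⟩ : WeierstrassCurve ℚ) = (q : ℂ)) (hv : padicValRat 3 q = 2) :
    BSDp (⟨a1, a2, a3, a4, a6⟩ : WeierstrassCurve ℚ) 3 := by
  have h0 : discOf [a1, a2, a3, a4, a6] ≠ 0 := fun h ↦ h3Δ (by rw [h]; exact dvd_zero _)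
  haveI := isElliptic_of_discOf_ne_zero a1 a2 a3 a4 a6 h0
  haveI := hmin
  haveI : Fact (Nat.Prime 3) := ⟨by norm_num⟩
  have hI : integralModelInt (⟨a1, a2, a3, a4, a6⟩ : WeierstrassCurve ℚ) = ⟨a1, a2, a3, a4, a6⟩ :=
    integralModelInt_eq_of_map_eq _ (map_mk_int a1 a2 a3 a4 a6)
  have hΔℓ : ((⟨a1, a2, a3, a4, a6⟩ : WeierstrassCurve ℤ).map (Int.castRingHom (ZMod ℓ))).Δ =
      ((discOf [a1, a2, a3, a4, a6] : ℤ) : ZMod ℓ) := by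
    rw [WeierstrassCurve.map_Δ, intCurve_Δ, eq_intCast]
  exact X8RankOne.bsdp_three_of_kim2025_OPEN_of_intModel_of_kuriharaNumber_ne_zero_of_card_selmerGroup
    hK25s hCT hGZK hmod hI (by rw [intCurve_Δ]; exact h3Δ)
    (natCard_point_eq_of_countPoints a1 a2 a3 a4 a6 3 (by decide) h3Δ hc₃) hn17 hsurj hr D hk hk4 ℓ
    (by omega) h5 (by rw [intCurve_Δ]; exact hℓΔ) h1 hnℓ hdvd (by rw [hΔℓ]; exact hΔ0)
    (by rw [hΔℓ]; exact hχ) ψ hψ hδ hcard hq hv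

end Literal

end Summit.BirchSwinnertonDyer.Rank1Residual.Supersingular

end
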